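import Summits.CriticalPhenomena.PercolationContinuityZ3.Theorems.PercNearOneGluingNoHeavyLowerTailSunflowerRainbowDichotomy
import HarnessLib
import HarnessLib.Audit

/-!
# `NoHeavyLowerTail` (crux stmt-CriticalPhenomena-4575), abstract sunflower cubic: the LINEAR-EXTENSION RAINBOW DICHOTOMY —
# CORRECTION of `RainbowDichotomy` (which is FALSE: twins) and the repaired sufficient condition for `RainbowMatroidPartition`

Support file (seat `prim-l12-p2` gen 22; `--supports stmt-CriticalPhenomena-4575`).  No `sorry`.  One new definition, the `@[conjecture]`
`RainbowLinearDichotomy` (an obligation of this programme — census-true, unproved —, never a fact).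
Memo: run/shared/lean/prim/prim-l12/prim-l12-p2/FINDING-g22-RAINBOW-DICHOTOMY.md.

STATUS OF `RainbowDichotomy` (`…SunflowerRainbowDichotomy`, this gen): **FALSE** (found after it landed; the formal refutation needs a 64-set
computation and is recorded in the memo / item evidence `ZZ-COUNTEREXAMPLE-n6.md`).  Witness on 6 points: petals `C1 = ↑{01} ∪ ↑{5}`,
`C2 = ↑{02} ∪ ↑{03} ∪ ↑{04}`, `C3 = ↑{12} ∪ ↑{13} ∪ ↑{14}` (minus the kernel), kernel `A ⊇ ↑{012},↑{013},↑{014},↑{025},↑{125},↑{035},↑{135},↑{235},↑{45}`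
(label string `0001023402340234023402340234023411111444144444444444444444444444`, set `S ↦` position `Σ_{i∈S} 2^i`).  The elements `2, 3` are TWINS;
the rainbows `ρ₁ = ({2,5},{0,3},{1,4})` and `ρ₂ = ({3,5},{0,2},{1,4})` are `RbBelow`-incomparable, `ρ₀ = ({5},{0,2,3},{1,4})` lies strictly below both,
`TS-B ρ₁ = TS-B ρ₀ + TS-B ρ₂` (so `DepB ρ₁`) and `TS-A ρ₁ = TS-A ρ₂` (= the unit vector at the supply `({0,1,4},{2,3,5},∅)`, so `DepA ρ₁`).
The partial order treats the two twins symmetrically; every TOTAL order puts one of them first, and then only the second is B-dependent.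

THE REPAIR (this file).  Replace the partial order by a LINEAR EXTENSION: an injective rank `r` on the rainbows with `RbBelow ρ' ρ → r ρ' < r ρ`.
* `RainbowLinearDichotomy` (conjecture (ZZ_L)): for EVERY sunflower and EVERY such rank, no rainbow `ρ` has both
  `TS-B ρ ∈ span {TS-B ρ' : r ρ' < r ρ}` and `TS-A ρ ∈ span {TS-A ρ' : r ρ < r ρ'}`.
  For the rank `lex(w(Q1), w'(Q3))` with additive weights this is gen 21's MP-GREEDY in span form.  CENSUS (gen 22, `code/zzlin.c`, kit j138766):
  8 families of linear extensions (lex of additive weights in both priorities, their sum, RANDOM linear extensions = random topological sorts,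
  `lex(|Q1|+|Q3|, random)`, `lex(|Q1|,|Q3|, random)`) on 180 298 compositions `θ∘gadgets` on ≤ 7 points (the family containing the twins
  counterexamples), 1 318 on ≤ 9 points, the cyclic star `CS(3,3,3)`, 1 848 all-petals-non-intersecting sunflowers on 7 points, 1 462 random on 6:
  0 failures (the partial-order form fails on the twin instances only).
* `Sunflower.exists_matroidPartition_of_rank` — for ONE sunflower: ANY injective rank whose dichotomy holds yields a matroid partition
  (`R_A := {ρ : TS-B ρ ∈ span of the r-earlier TS-B}`, the greedy-rejected set; leading-term lemma `linearIndependent_of_not_mem_span_adm` of the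
  previous file with weight `r`, resp. `M − r`).  Monotonicity along `RbBelow` is not used here — it is what makes the hypothesis plausible.
* **`rainbowMatroidPartition_of_rainbowLinearDichotomy`** : (ZZ_L) ⟹ MP (a linear extension of `RbBelow` exists: rank `(|Q1|+|Q3|)·K + index`).
* **`partitionLemmaH_of_rainbowLinearDichotomy`** : (ZZ_L) ⟹ ★.
-/

namespace Summit.CriticalPhenomena.PercolationContinuityZ3.Theorems.SunflowerPartition

open Finset

variable {α : Type*} [Fintype α] [DecidableEq α]

namespace Sunflower

variable (F : Sunflower α)

/-- **Matroid partition from a rank dichotomy, one sunflower** (this work).  If `r` is injective on the rainbows and no rainbow `ρ` has both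
`TS-B ρ ∈ span{TS-B ρ' : r ρ' < r ρ}` and `TS-A ρ ∈ span{TS-A ρ' : r ρ < r ρ'}`, then `R_A := {ρ : TS-B ρ ∈ span of the r-earlier}` and its complement
`R_B` form a rainbow matroid partition of `F`. [this work] -/
theorem exists_matroidPartition_of_rank (r : Finset α × Finset α → ℕ) (hinj : Set.InjOn r ↑F.rainbows)
    (hd : ∀ ρ ∈ F.rainbows, ¬ (F.tsB ρ ∈ Submodule.span (ZMod 2) (F.tsB '' {ρ' | ρ' ∈ F.rainbows ∧ r ρ' < r ρ}) ∧
                              F.tsA ρ ∈ Submodule.span (ZMod 2) (F.tsA '' {ρ' | ρ' ∈ F.rainbows ∧ r ρ < r ρ'}))) :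
    ∃ RB RA : Finset (Finset α × Finset α),
      RB ⊆ F.dem.filter (fun d => F.IsRainbow d) ∧ RA ⊆ F.dem.filter (fun d => F.IsRainbow d) ∧ Disjoint RB RA ∧
      RB ∪ RA = F.dem.filter (fun d => F.IsRainbow d) ∧
      LinearIndependent (ZMod 2)
        (fun ρ : ↥RB => fun σ : ↥(F.sup.filter (fun σ => F.lab σ.2 = 0)) => F.rbVec ρ.1 σ.1) ∧
      LinearIndependent (ZMod 2)
        (fun ρ : ↥RA => fun σ : ↥(F.sup.filter (fun σ => F.lab σ.2 = 4)) => F.rbVec ρ.1 σ.1) := by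
  classical
  -- the greedy-rejected set
  let P : Finset α × Finset α → Prop := fun ρ =>
    F.tsB ρ ∈ Submodule.span (ZMod 2) (F.tsB '' {ρ' | ρ' ∈ F.rainbows ∧ r ρ' < r ρ})
  have hrb : F.rainbows = F.dem.filter (fun d => F.IsRainbow d) := rfl
  refine ⟨F.rainbows.filter (fun ρ => ¬ P ρ), F.rainbows.filter (fun ρ => P ρ), ?_, ?_, ?_, ?_, ?_, ?_⟩
  · rw [← hrb]; exact Finset.filter_subset _ _
  · rw [← hrb]; exact Finset.filter_subset _ _
  · exact Finset.disjoint_filter.2 fun _ _ h1 h2 => h1 h2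
  · rw [← Finset.filter_or, ← hrb]
    ext ρ
    simp only [Finset.mem_filter]
    tauto
  · -- B-side: weight r, admissible = r-earlier
    have key := linearIndependent_of_not_mem_span_adm (K := ZMod 2) (F.rainbows.filter (fun ρ => ¬ P ρ)) F.tsB
      r (fun ρ ρ' => r ρ' < r ρ) ?_ ?_
    · exact key
    · intro i hi j hj hne hadm
      have hi' := (Finset.mem_filter.1 hi).1
      have hj' := (Finset.mem_filter.1 hj).1
      rcases lt_trichotomy (r j) (r i) with h | h | h
      · exact absurd h hadm
      · exact absurd (hinj (Finset.mem_coe.2 hj') (Finset.mem_coe.2 hi') h) hne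
      · exact h
    · intro i hi hmem
      have hnot : ¬ P i := (Finset.mem_filter.1 hi).2
      apply hnot
      refine Submodule.span_mono (Set.image_mono ?_) hmem
      intro j hj
      exact ⟨(Finset.mem_filter.1 hj.1).1, hj.2.2⟩
  · -- A-side: weight M - r with M above all ranks, admissible = r-later
    let M : ℕ := F.rainbows.sup r + 1
    have hM : ∀ ρ ∈ F.rainbows, r ρ < M := fun ρ hρ => Nat.lt_succ_of_le (Finset.le_sup hρ)
    have key := linearIndependent_of_not_mem_span_adm (K := ZMod 2) (F.rainbows.filter (fun ρ => P ρ)) F.tsA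
      (fun ρ => M - r ρ) (fun ρ ρ' => r ρ < r ρ') ?_ ?_
    · exact key
    · intro i hi j hj hne hadm
      have hi' := (Finset.mem_filter.1 hi).1
      have hj' := (Finset.mem_filter.1 hj).1
      have hiM := hM i hi'
      have hjM := hM j hj'
      rcases lt_trichotomy (r i) (r j) with h | h | h
      · exact absurd h hadm
      · exact absurd (hinj (Finset.mem_coe.2 hj') (Finset.mem_coe.2 hi') h.symm) hne
      · show M - r i < M - r j
        omega
    · intro i hi hmem
      have hPi : P i := (Finset.mem_filter.1 hi).2
      have hnotA := hd i (Finset.mem_filter.1 hi).1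
      apply hnotA
      refine ⟨hPi, ?_⟩
      refine Submodule.span_mono (Set.image_mono ?_) hmem
      intro j hj
      exact ⟨(Finset.mem_filter.1 hj.1).1, hj.2.2⟩

end Sunflower

/-! ## The typed conjecture (linear extensions) and the reduction -/

/-- **LINEAR-EXTENSION RAINBOW DICHOTOMY (ZZ_L)** (this work; OPEN, census-clean — file header; replaces the FALSE `RainbowDichotomy`): for every
sunflower and every injective rank `r` on its rainbows that is strictly monotone along `RbBelow` (a linear extension of the `(Q1,Q3)` product
order), no rainbow `ρ` has both `TS-B ρ ∈ span{TS-B ρ' : r ρ' < r ρ}` and `TS-A ρ ∈ span{TS-A ρ' : r ρ < r ρ'}`.  An obligation, never a fact: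
use as `(h : RainbowLinearDichotomy)`. [status: open] -/
@[conjecture] def RainbowLinearDichotomy : Prop :=
  ∀ (α : Type) [Fintype α] [DecidableEq α] (F : Sunflower α) (r : Finset α × Finset α → ℕ),
    Set.InjOn r ↑F.rainbows →
    (∀ ρ' ρ, ρ' ∈ F.rainbows → ρ ∈ F.rainbows → RbBelow ρ' ρ → r ρ' < r ρ) →
    ∀ ρ ∈ F.rainbows, ¬ (F.tsB ρ ∈ Submodule.span (ZMod 2) (F.tsB '' {ρ' | ρ' ∈ F.rainbows ∧ r ρ' < r ρ}) ∧
                       F.tsA ρ ∈ Submodule.span (ZMod 2) (F.tsA '' {ρ' | ρ' ∈ F.rainbows ∧ r ρ < r ρ'}))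

/-- A linear extension of `RbBelow` on the rainbows of a sunflower: the rank `(|Q1|+|Q3|)·K + index` (`K` = number of rainbows). [this work] -/
theorem exists_rank_linearExtension (F : Sunflower α) :
    ∃ r : Finset α × Finset α → ℕ, Set.InjOn r ↑F.rainbows ∧
      ∀ ρ' ρ, ρ' ∈ F.rainbows → ρ ∈ F.rainbows → RbBelow ρ' ρ → r ρ' < r ρ := by
  classical
  let K : ℕ := F.rainbows.card
  let e : ↥F.rainbows ≃ Fin K := F.rainbows.equivFin
  let idx : Finset α × Finset α → ℕ := fun ρ => if h : ρ ∈ F.rainbows then (e ⟨ρ, h⟩ : ℕ) else 0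
  have hidx : ∀ ρ ∈ F.rainbows, idx ρ < K := by
    intro ρ hρ; simp only [idx, dif_pos hρ]; exact (e ⟨ρ, hρ⟩).isLt
  let w : Finset α × Finset α → ℕ := fun ρ => ρ.1.card + ((ρ.1 ∪ ρ.2)ᶜ).card
  refine ⟨fun ρ => w ρ * K + idx ρ, ?_, ?_⟩
  · intro ρ hρ ρ' hρ' heq
    have hρm : ρ ∈ F.rainbows := Finset.mem_coe.1 hρ
    have hρ'm : ρ' ∈ F.rainbows := Finset.mem_coe.1 hρ'
    have hK : 0 < K := Finset.card_pos.2 ⟨ρ, hρm⟩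
    have h1 := hidx ρ hρm
    have h2 := hidx ρ' hρ'm
    have key : ∀ a b i j : ℕ, i < K → j < K → a * K + i = b * K + j → a = b ∧ i = j := by
      intro a b i j hi hj h
      have ha : (a * K + i) / K = a := by
        rw [Nat.add_comm, Nat.add_mul_div_right _ _ hK, Nat.div_eq_of_lt hi, Nat.zero_add]
      have hb : (b * K + j) / K = b := by
        rw [Nat.add_comm, Nat.add_mul_div_right _ _ hK, Nat.div_eq_of_lt hj, Nat.zero_add]
      have hab : a = b := by rw [← ha, ← hb, h]
      subst hab
      exact ⟨rfl, Nat.add_left_cancel h⟩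
    have hi : idx ρ = idx ρ' := (key _ _ _ _ h1 h2 heq).2
    simp only [idx, dif_pos hρm, dif_pos hρ'm] at hi
    have := e.injective (Fin.ext hi)
    exact congrArg Subtype.val this
  · intro ρ' ρ hρ' hρ hb
    have hlt : w ρ' < w ρ := RbBelow.weight_lt hb
    have h1 := hidx ρ' hρ'
    have key : ∀ a b i j : ℕ, a < b → i < K → a * K + i < b * K + j := by
      intro a b i j hab hi
      calc a * K + i < a * K + K := Nat.add_lt_add_left hi _
        _ = (a + 1) * K := by ring
        _ ≤ b * K := Nat.mul_le_mul_right _ hab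
        _ ≤ b * K + j := Nat.le_add_right _ _
    exact key _ _ _ _ hlt h1

/-- **(ZZ_L) ⟹ MP** (this work). [this work] -/
theorem rainbowMatroidPartition_of_rainbowLinearDichotomy (h : RainbowLinearDichotomy) : RainbowMatroidPartition := by
  intro α _ _ F
  obtain ⟨r, hinj, hmono⟩ := exists_rank_linearExtension F
  exact F.exists_matroidPartition_of_rank r hinj (h α F r hinj hmono)

/-- **(ZZ_L) ⟹ ★** (this work). [this work] -/
theorem partitionLemmaH_of_rainbowLinearDichotomy (h : RainbowLinearDichotomy) : PartitionLemmaH :=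
  partitionLemmaH_of_rainbowMatroidPartition (rainbowMatroidPartition_of_rainbowLinearDichotomy h)

end Summit.CriticalPhenomena.PercolationContinuityZ3.Theorems.SunflowerPartition
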